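import Mathlib
import Summits.Ventures.PercRepro2.Defs
import Summits.Ventures.PercRepro2.Graph
import Summits.Ventures.PercRepro2.OneColourSwitch
import Summits.Ventures.PercRepro2.RegionHubSign
import Summits.Ventures.PercRepro2.SideSwitch
import Summits.Ventures.PercRepro2.SideSwitchFibre
import Summits.Ventures.PercRepro2.SideSwitchClosed
import Summits.Ventures.PercRepro2.SideSwitchComps
import Summits.Ventures.PercRepro2.SideSwitchCompsFibre
import Summits.Ventures.PercRepro2.M9NoPocketDefs
import Summits.Ventures.PercRepro2.M9NoPocketWorld
import Summits.Ventures.PercRepro2.M9NoPocketWorldD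
import Summits.Ventures.PercRepro2.M9NoPocketFibre
import Summits.Ventures.PercRepro2.M9SubcubeHarris
import Summits.Ventures.PercRepro2.M9ClusterFibreHarris
import Summits.Ventures.PercRepro2.M9ClusterAvoidHarris
import Summits.Ventures.PercRepro2.M9PocketUnitFibre
import Summits.Ventures.PercRepro2.M9PocketUnitFibreSum
import Summits.Ventures.PercRepro2.M9PocketPsi2
import Summits.Ventures.PercRepro2.M9PocketPsi2Sign

/-!
# The legality of the flipped point is monotone along the exploration fibre (blind cell
PercRepro2, p3 g39, 2026-08-29; `proofs/P3-POCKETRK.md` §5″ Step 2–3 and §9 K5/K6: the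
unpaired set is a lower set)

Let `ρ` be a clean `K`-point (no `W`-side in `G − d`, every edge from `d` into the `Y`-world
of `G − d` open) and `C` a closed set of `Y`-side blocks.  For `ω₁ ≤ ω₂` in the exploration
fibre of `ρ` (`M9PocketUnitFibre`: agreement with `ρ` on the edges touching
`U = C_Y(d) ∪ K₂(G − d) ∪ M₂(G − d)`), the flipped points `Ψ ω_i` (every edge not touching
`C` flipped) satisfy `Ψ ω₂ ≤ Ψ ω₁` (`psi2_le_psi2_of_le`), and **every legality condition of
an `EX` point of configuration `C` with `σ_rs = 1` passes from `Ψ ω₁` to `Ψ ω₂`**: the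
`Y`-side of `G − d` is `C` (`K2_endsD_psi2_fibre`), `d` keeps its `Y` edge into `C` and its
`W` edge into the `W`-side (`d_mem_K2_psi2_of_le`, `d_mem_M2_psi2_of_le`), the `W`-clusters of
`r` and `s` only shrink (`cluster_compl_psi2_subset_of_le`: they never use a free edge).
Part 2 (`M9PocketPsi2MonoLink`): `Sep`, `DOne`, the `Y`-link and «no `W`-link» pass, hence
the whole legality (`legal_psi2_of_le`) — the statement «`E` is a decreasing event on the
fibre» of `proofs/P3-POCKETRK.md` §5″ Step 3, in the form the fibre Harris of
`M9PocketUnitFibreSum` consumes.  Own work; std axioms.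
-/

namespace Summit.Ventures.PercRepro2

namespace NoPocket

open Finset Classical OneColourSwitch SideSwitch

variable {V : Type*} {E : Type*} {ends : E → Sym2 V} {p q r s d : V} {ρ : Config E}
  {C : Set V}

section Fibre

variable (hdr : d ≠ r) (hds : d ≠ s) (hrs : within ends ({r, s} : Set V) = ∅)
  (hT : ∀ e, ends e ≠ s(d, r) ∧ ends e ≠ s(d, s))
  (hsep : sep2 ends p q r s ρ) (hD : DOne ends r s d ρ)
  (hB : ∀ x ∈ M2 (endsD ends d) r s ρ, x = r ∨ x = s)
  (hC : C ⊆ K2 (endsD ends d) r s ρ) (hCr : r ∉ C) (hCs : s ∉ C)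
  (hcl : ClosedIn (endsD ends d) (sided (endsD ends d) r s ρ) C)
  {ω₁ ω₂ : Config E}
  (h₁ : ∀ e ∈ touches ends (cluster ends ρ d ∪ K2 (endsD ends d) r s ρ ∪
    M2 (endsD ends d) r s ρ), ω₁ e = ρ e)
  (h₂ : ∀ e ∈ touches ends (cluster ends ρ d ∪ K2 (endsD ends d) r s ρ ∪
    M2 (endsD ends d) r s ρ), ω₂ e = ρ e)
  (hle : ω₁ ≤ ω₂)

include hC h₁ h₂ hle in
/-- The flipped points are ordered the other way. -/
lemma psi2_le_psi2_of_le :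
    (fun e => if e ∈ touches ends C then ω₂ e else !ω₂ e) ≤
      (fun e => if e ∈ touches ends C then ω₁ e else !ω₁ e) := by
  intro e
  by_cases he : e ∈ touches ends C
  · simp only [if_pos he]
    have hU : e ∈ touches ends (cluster ends ρ d ∪ K2 (endsD ends d) r s ρ ∪
        M2 (endsD ends d) r s ρ) := by
      obtain ⟨x, hx, y, hxy⟩ := he
      exact ⟨x, Or.inl (Or.inr (hC hx)), y, hxy⟩
    rw [h₁ e hU, h₂ e hU]
  · simp only [if_neg he]
    have := hle e
    revert this
    cases ω₁ e <;> cases ω₂ e <;> simp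

include hdr hds hrs hT hsep hB hC hCr hCs hcl h₂ in
/-- The `Y`-side of `G − d` at the flipped point is `C` together with `r, s`. -/
lemma K2_endsD_psi2_fibre :
    K2 (endsD ends d) r s (fun e => if e ∈ touches ends C then ω₂ e else !ω₂ e) =
      M2 (endsD ends d) r s ρ ∪ C := by
  have hsep₂ := (sep2_iff_on_unitFibre hdr hds hrs hT hB h₂).2 hsep
  have hD₂ := DOne_on_unitFibre hdr hds hrs hT hB h₂
  have hK₂ := K2_endsD_eq_on_unitFibre hdr hds h₂
  have hM₂ := M2_endsD_eq_on_unitFibre hdr hds h₂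
  have hC₂ : C ⊆ K2 (endsD ends d) r s ω₂ := by rw [hK₂]; exact hC
  have hcl₂ : ClosedIn (endsD ends d) (sided (endsD ends d) r s ω₂) C := by
    have hsid : sided (endsD ends d) r s ω₂ = sided (endsD ends d) r s ρ := by
      ext x; simp only [sided, Set.mem_setOf_eq, hK₂, hM₂]
    rw [hsid]; exact hcl
  rw [K2_endsD_psi2 hdr hds hsep₂ hD₂ hC₂ hCr hCs hcl₂, hM₂]

include hdr hds hrs hT hsep hB hC hCr hCs hcl h₂ in
/-- The `W`-side of `G − d` at the flipped point is the `Y`-side of `ρ` without `C`. -/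
lemma M2_endsD_psi2_fibre :
    M2 (endsD ends d) r s (fun e => if e ∈ touches ends C then ω₂ e else !ω₂ e) =
      K2 (endsD ends d) r s ρ \ C := by
  have hsep₂ := (sep2_iff_on_unitFibre hdr hds hrs hT hB h₂).2 hsep
  have hD₂ := DOne_on_unitFibre hdr hds hrs hT hB h₂
  have hK₂ := K2_endsD_eq_on_unitFibre hdr hds h₂
  have hM₂ := M2_endsD_eq_on_unitFibre hdr hds h₂
  have hC₂ : C ⊆ K2 (endsD ends d) r s ω₂ := by rw [hK₂]; exact hC
  have hcl₂ : ClosedIn (endsD ends d) (sided (endsD ends d) r s ω₂) C := by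
    have hsid : sided (endsD ends d) r s ω₂ = sided (endsD ends d) r s ρ := by
      ext x; simp only [sided, Set.mem_setOf_eq, hK₂, hM₂]
    rw [hsid]; exact hcl
  rw [M2_endsD_psi2 hdr hds hsep₂ hD₂ hC₂ hCr hCs hcl₂, hK₂]

omit hsep hD hB hC hCr hCs hcl hle in
include hdr hds hT h₁ h₂ in
/-- `d` keeps its `Y` edge into `C`: `d ∈ K₂` passes from `Ψ ω₁` to `Ψ ω₂`. -/
lemma d_mem_K2_psi2_of_le
    (hK₁' : K2 (endsD ends d) r s (fun e => if e ∈ touches ends C then ω₁ e else !ω₁ e) =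
      M2 (endsD ends d) r s ρ ∪ C)
    (hK₂' : K2 (endsD ends d) r s (fun e => if e ∈ touches ends C then ω₂ e else !ω₂ e) =
      M2 (endsD ends d) r s ρ ∪ C)
    (hB : ∀ x ∈ M2 (endsD ends d) r s ρ, x = r ∨ x = s)
    (hK : d ∈ K2 ends r s (fun e => if e ∈ touches ends C then ω₁ e else !ω₁ e)) :
    d ∈ K2 ends r s (fun e => if e ∈ touches ends C then ω₂ e else !ω₂ e) := by
  obtain ⟨e, y, hey, he, hy⟩ := exists_open_edge_d_of_mem_K2 hdr hds hK
  rw [hK₁'] at hy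
  have hyC : y ∈ C := by
    rcases hy with hy | hy
    · rcases hB y hy with rfl | rfl
      · exact ((hT e).1 hey).elim
      · exact ((hT e).2 hey).elim
    · exact hy
  have htC : e ∈ touches ends C := mem_touches_of_ends hey (Or.inr hyC)
  have hU : e ∈ touches ends (cluster ends ρ d ∪ K2 (endsD ends d) r s ρ ∪
      M2 (endsD ends d) r s ρ) :=
    ⟨d, Or.inl (Or.inl (mem_cluster_self ends ρ d)), y, hey⟩
  have hyK : y ∈ K2 (endsD ends d) r s (fun e => if e ∈ touches ends C then ω₂ e else !ω₂ e) := by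
    rw [hK₂']; exact Or.inr hyC
  refine mem_K2_of_open (K2_endsD_subset_K2 _ hyK) ?_ (by rw [hey, Sym2.eq_swap])
  simp only [psi2_of_mem htC] at he ⊢
  rw [h₂ e hU, ← h₁ e hU]
  exact he

omit hsep hD hB hC hCr hCs hcl hle in
include hdr hds h₁ h₂ in
/-- `d` keeps its `W` edge into the `W`-side: `d ∈ M₂` passes from `Ψ ω₁` to `Ψ ω₂`. -/
lemma d_mem_M2_psi2_of_le
    (hM₁' : M2 (endsD ends d) r s (fun e => if e ∈ touches ends C then ω₁ e else !ω₁ e) =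
      K2 (endsD ends d) r s ρ \ C)
    (hM₂' : M2 (endsD ends d) r s (fun e => if e ∈ touches ends C then ω₂ e else !ω₂ e) =
      K2 (endsD ends d) r s ρ \ C)
    (hM : d ∈ M2 ends r s (fun e => if e ∈ touches ends C then ω₁ e else !ω₁ e)) :
    d ∈ M2 ends r s (fun e => if e ∈ touches ends C then ω₂ e else !ω₂ e) := by
  -- the mirror of `exists_open_edge_d_of_mem_K2` through the colour flip
  have hK : d ∈ K2 ends r s (OneColourSwitch.compl
      (fun e => if e ∈ touches ends C then ω₁ e else !ω₁ e)) := by rw [K2_compl]; exact hM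
  obtain ⟨e, y, hey, he, hy⟩ := exists_open_edge_d_of_mem_K2 hdr hds hK
  rw [K2_compl, hM₁'] at hy
  have hU : e ∈ touches ends (cluster ends ρ d ∪ K2 (endsD ends d) r s ρ ∪
      M2 (endsD ends d) r s ρ) :=
    ⟨d, Or.inl (Or.inl (mem_cluster_self ends ρ d)), y, hey⟩
  have hyM : y ∈ M2 (endsD ends d) r s (fun e => if e ∈ touches ends C then ω₂ e else !ω₂ e) := by
    rw [hM₂']; exact hy
  have he' : (fun e => if e ∈ touches ends C then ω₂ e else !ω₂ e) e = false := by
    simp only [OneColourSwitch.compl, Bool.not_eq_true'] at he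
    have : ω₂ e = ω₁ e := by rw [h₂ e hU, h₁ e hU]
    simp only [this]
    exact he
  exact mem_M2_of_closed (M2_endsD_subset_M2 _ hyM) he' (by rw [hey, Sym2.eq_swap])

include hdr hds hB hC hCr hCs h₁ h₂ in
/-- **The `W`-clusters of `r` and `s` only shrink**: a `W`-path of `Ψ ω₂` from `r` never uses a
free edge (it stays inside `U ∖ C`, where every edge is fixed), so it is a `W`-path of
`Ψ ω₁`. -/
lemma cluster_compl_psi2_subset_of_le
    (hK₁' : K2 (endsD ends d) r s (fun e => if e ∈ touches ends C then ω₁ e else !ω₁ e) =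
      M2 (endsD ends d) r s ρ ∪ C)
    (hD₁ : DOne ends r s d (fun e => if e ∈ touches ends C then ω₁ e else !ω₁ e))
    {t : V} (ht : t = r ∨ t = s) :
    cluster ends (OneColourSwitch.compl
        (fun e => if e ∈ touches ends C then ω₂ e else !ω₂ e)) t ⊆
      cluster ends (OneColourSwitch.compl
        (fun e => if e ∈ touches ends C then ω₁ e else !ω₁ e)) t := by
  intro y hy
  have htU : t ∈ cluster ends ρ d ∪ K2 (endsD ends d) r s ρ ∪ M2 (endsD ends d) r s ρ := by
    rcases ht with rfl | rfl
    · exact Or.inl (Or.inr (r_mem_K2 t s ρ))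
    · exact Or.inl (Or.inr (s_mem_K2 r t ρ))
  have htC : t ∉ C := by
    rcases ht with rfl | rfl
    · exact hCr
    · exact hCs
  have key : y ∈ {z | Conn ends (OneColourSwitch.compl
      (fun e => if e ∈ touches ends C then ω₁ e else !ω₁ e)) t z ∧
      z ∈ cluster ends ρ d ∪ K2 (endsD ends d) r s ρ ∪ M2 (endsD ends d) r s ρ ∧ z ∉ C} := by
    refine mem_of_conn_of_closed ?_ ⟨conn_refl _ _ _, htU, htC⟩ hy
    rintro a ⟨hac, haU, haC⟩ b hab
    obtain ⟨_, e, he, hends⟩ := openGraph_adj.1 hab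
    have hU : e ∈ touches ends (cluster ends ρ d ∪ K2 (endsD ends d) r s ρ ∪
        M2 (endsD ends d) r s ρ) := mem_touches_of_ends hends (Or.inl haU)
    -- the edge is fixed: `Ψ ω₂ e = Ψ ω₁ e`
    have hfix : (if e ∈ touches ends C then ω₂ e else !ω₂ e) =
        (if e ∈ touches ends C then ω₁ e else !ω₁ e) := by
      simp only [h₁ e hU, h₂ e hU]
    have he₁ : OneColourSwitch.compl
        (fun e => if e ∈ touches ends C then ω₁ e else !ω₁ e) e = true := by
      simp only [OneColourSwitch.compl] at he ⊢
      rw [← hfix]; exact he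
    have hbc : Conn ends (OneColourSwitch.compl
        (fun e => if e ∈ touches ends C then ω₁ e else !ω₁ e)) t b :=
      conn_trans hac (conn_of_openAdj ⟨e, he₁, hends⟩)
    refine ⟨hbc, ?_, ?_⟩
    · -- `b ∈ U`: an edge from `U ∖ C` leaving `U` is `W` at `ρ` and flipped, hence `Y`
      by_contra hbU
      have hbC : b ∉ C := fun hb => hbU (Or.inl (Or.inr (hC hb)))
      have hnt : e ∉ touches ends C := not_mem_touches_of_ends hends haC hbC
      have hρe : ρ e = false :=
        edge_into_U_closed hdr hds hB (by rw [hends, Sym2.eq_swap]) hbU haU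
      simp only [OneColourSwitch.compl] at he₁
      rw [psi2_of_notMem hnt, h₁ e hU, hρe] at he₁
      exact absurd he₁ (by decide)
    · -- `b ∉ C`: a vertex of `C` is `Y`-reached at `Ψ ω₁`, and would be doubly reached
      intro hbC
      have hbK : b ∈ K2 ends r s (fun e => if e ∈ touches ends C then ω₁ e else !ω₁ e) :=
        K2_endsD_subset_K2 _ (by rw [hK₁']; exact Or.inr hbC)
      have hbM : b ∈ M2 ends r s (fun e => if e ∈ touches ends C then ω₁ e else !ω₁ e) := by
        rcases ht with rfl | rfl
        · exact mem_M2_iff.2 (Or.inl hbc)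
        · exact mem_M2_iff.2 (Or.inr hbc)
      have hbd : b ≠ d := by rintro rfl; exact not_mem_K2_endsD hdr hds ρ (hC hbC)
      exact hD₁ b (fun h => hCr (h ▸ hbC)) (fun h => hCs (h ▸ hbC)) hbd hbK hbM
  exact key.1

end Fibre

end NoPocket

end Summit.Ventures.PercRepro2
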